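import Summits.BirchSwinnertonDyer.Rank1Residual.Additive.CyclotomicThreeReduction
import HarnessLib

/-!
# `K = ℚ(ζ_p)`-side reduction data for every prime `p`: the unique prime `𝔭 ∣ p`, `k_𝔭 = 𝔽_p`,
# `#Ẽ_𝔭(k_𝔭) = #V(𝔽_p)`, `a_𝔭(V_K) = a_p(V)`, `#Ẽ_𝔭(k_𝔭)[p^∞] = #V(𝔽_p)[p^∞]`

HONEST FRAMING (cell `b2b-bsdres`, run/shared/lean/b2b/bsd-rank1-residual/, verbatim in every
file): the goal of the cell is to DELETE the COMBINATION-SHAPED residual classes of the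
Birch–Swinnerton-Dyer formula for ALL analytic-rank `≤ 1` elliptic curves over `ℚ` — "full BSD
formula for every rank `≤ 1` curve in class `C`" assembled STRICTLY from published theorems — so
that the rank-`≤ 1` remainder becomes exactly the CONSTRUCTION-SHAPED classes, which are TYPED
(missing-input `Prop`s), NOT attempted. This is not "finishing BSD". The additive sub-cell (seats
additive-p1…p4) is a RESEARCH ROUTE on the construction-shaped classes X3/X4; no claim beyond the
stated classes; no label moves; nothing is booked here.

Theorems only (no `def`, no `sorry`, no named fact). The `p`-GENERAL version of
`CyclotomicThreeReduction.lean` (gen 5, `p = 3`): the `K`-side facts about `K = ℚ(ζ_p)` and the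
canonical model `V ⊗ K` of a globally minimal `V/ℚ` with good reduction at `p` that are needed to
project Greenberg's Euler-characteristic formula over the number field `K`
(`Greenberg1999.thm41_charValue_rankZero_numberField`, anomalous factor `∏_{v ∣ p} #Ẽ_v(k_v)[p^∞]²`)
onto `ℚ`-side data — prepared for the designed line V19 of the additive sub-cell (rank-`(0,0)`
X3/X4 rows at `p ≥ 5` over `F = ℚ(μ_p)`; HOME/b2b-bsdres-additive-p4/REPAIR-CENSUS.md, gen-8 block),
and usable by every seat working over `ℚ(μ_p)`:

* `exists_prime_over_prime` — `p` is totally ramified in `ℚ(ζ_p)`: there is a finite place `𝔭`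
  (namely `(ζ_p − 1)`) with `p ∈ 𝔭`, `{v | p ∈ v} = {𝔭}` and `N(𝔭) = p` (Mathlib:
  `IsCyclotomicExtension.Rat.eq_span_zeta_sub_one_of_liesOver'`, `inertiaDeg_eq_of_prime`,
  `Ideal.pow_inertiaDeg`);
* `natCard_residueField_adicCompletionIntegers_eq_of_absNorm` — `#k_𝔭 = N(𝔭)`;
* `natCard_point_reductionAt_baseChange_eq_reductionPointCount_prime` — `#Ẽ_𝔭(k_𝔭) = #V(𝔽_p)` for
  `p ∤ Δ_min(V)` (Mathlib's chosen minimal model of `V_K ⊗ K_𝔭` versus `V_ℤ ⊗ 𝒪_𝔭`, Silverman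
  VII.1.3(b), `k_𝔭 ≃ ℤ/p`);
* `frobeniusTraceAt_baseChange_eq_frobeniusTrace_prime` — `a_𝔭(V_K) = a_p(V)`;
* `natCard_primaryComponent_point_reductionAt_eq_prime` — `#Ẽ_𝔭(k_𝔭)[p^∞] = #V(𝔽_p)[p^∞]`.
(The minimality / good reduction of `V ⊗ K` at a place above `p` for `p ∤ Δ_min(V)` is already
`p`-general: `isMinimalAt_and_hasGoodReductionAt_baseChange_of_mem`.)

References: Silverman, *AEC*, VII.1 Prop. 1.3(b), VII.2, VII.5 Prop. 5.1(a); Washington, GTM 83,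
Lemma 1.4 — via `Mathlib.NumberTheory.NumberField.Cyclotomic.Ideal`.
-/

noncomputable section

open scoped Classical NumberField

open WeierstrassCurve NumberField IsDedekindDomain IsLocalRing
  Literature.NumberTheory.EllipticCurves

namespace Summit.BirchSwinnertonDyer.Rank1Residual.Additive

/-! ## §1 The unique prime of `ℚ(ζ_p)` above `p` -/

section PrimeOver

variable (p : ℕ) [hp : Fact p.Prime] (K : Type) [Field K] [NumberField K]
  [IsCyclotomicExtension {p} ℚ K]

/-- **`p` is totally ramified in `K = ℚ(ζ_p)`**: there is a finite place `𝔭` (namely `(ζ_p − 1)`)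
with `p ∈ 𝔭`, every finite place containing `p` equals `𝔭`, and `N(𝔭) = p` (residue degree `1`).
Mathlib: `IsCyclotomicExtension.Rat.eq_span_zeta_sub_one_of_liesOver'`, `inertiaDeg_eq_of_prime`,
`Ideal.pow_inertiaDeg`. [folklore] -/
theorem exists_prime_over_prime :
    ∃ 𝔭 : HeightOneSpectrum (𝓞 K), ((p : ℕ) : 𝓞 K) ∈ 𝔭.asIdeal ∧
      {v : HeightOneSpectrum (𝓞 K) | ((p : ℕ) : 𝓞 K) ∈ v.asIdeal} = {𝔭} ∧
      Ideal.absNorm 𝔭.asIdeal = p := by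
  haveI : NeZero p := ⟨hp.out.ne_zero⟩
  have hζ := IsCyclotomicExtension.zeta_spec p ℚ K
  have hprime : Prime (hζ.toInteger - 1) := hζ.zeta_sub_one_prime'
  have hP : (Ideal.span {hζ.toInteger - 1}).IsPrime :=
    (Ideal.span_singleton_prime hprime.ne_zero).mpr hprime
  have hPne : Ideal.span {hζ.toInteger - 1} ≠ ⊥ := by
    rw [Ne, Ideal.span_singleton_eq_bot]
    exact hprime.ne_zero
  let 𝔭 : HeightOneSpectrum (𝓞 K) := ⟨Ideal.span {hζ.toInteger - 1}, hP, hPne⟩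
  have hmem : ((p : ℕ) : 𝓞 K) ∈ 𝔭.asIdeal := by
    have h := (IsCyclotomicExtension.Rat.zeta_sub_one_dvd_intCast_iff' p hζ (n := p)).mpr dvd_rfl
    rw [Ideal.mem_span_singleton]
    exact_mod_cast h
  refine ⟨𝔭, hmem, ?_, ?_⟩
  · ext v
    simp only [Set.mem_setOf_eq, Set.mem_singleton_iff]
    constructor
    · intro hv
      haveI : v.asIdeal.LiesOver (Ideal.span {((p : ℕ) : ℤ)}) :=
        Ideal.liesOver_span_of_natCast_mem' hp.out hv
      exact HeightOneSpectrum.ext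
        (IsCyclotomicExtension.Rat.eq_span_zeta_sub_one_of_liesOver' p K hζ v.asIdeal)
    · rintro rfl
      exact hmem
  · haveI : 𝔭.asIdeal.LiesOver (Ideal.span {((p : ℕ) : ℤ)}) :=
      Ideal.liesOver_span_of_natCast_mem' hp.out hmem
    have h1 := IsCyclotomicExtension.Rat.inertiaDeg_eq_of_prime p K 𝔭.asIdeal
    have h2 := Ideal.pow_inertiaDeg p 𝔭.asIdeal
    rw [h1, pow_one] at h2
    exact h2.symm

end PrimeOver

section ResidueField

variable {K : Type} [Field K] [NumberField K]

/-- `#k_𝔭 = N(𝔭)` for the residue field of the completion `𝒪_𝔭` at a finite place. [folklore] -/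
theorem natCard_residueField_adicCompletionIntegers_eq_of_absNorm (𝔭 : HeightOneSpectrum (𝓞 K))
    {n : ℕ} (hN : Ideal.absNorm 𝔭.asIdeal = n) :
    Nat.card (ResidueField (𝔭.adicCompletionIntegers K)) = n := by
  rw [HeightOneSpectrum.natCard_residueField_adicCompletionIntegers K 𝔭, ← Submodule.cardQuot_apply,
    ← Ideal.absNorm_apply, hN]

end ResidueField

/-! ## §2 The canonical model `V ⊗ K` at the prime above `p` -/

section Reduction

variable {K : Type} [Field K] [NumberField K]
  (V : WeierstrassCurve ℚ) [V.IsElliptic] [V.IsGloballyMinimal] (p : ℕ) [hp : Fact p.Prime]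

/-- **`#Ẽ_𝔭(k_𝔭) = #V(𝔽_p)`.** For `V/ℚ` globally minimal with `p ∤ Δ_min(V)` and a place `𝔭` of `K`
with `p ∈ 𝔭`, `N(𝔭) = p`: the reduction at `𝔭` of Mathlib's chosen minimal model of `V_K ⊗ K_𝔭` has as
many `k_𝔭`-points as the reduction mod `p` of the global minimal model of `V`
(`reductionPointCount V p`). Two minimal models have reductions with equally many points (Silverman
VII.1.3(b), tree `natCard_point_reduction_minimal`); the integral model of `V_K ⊗ K_𝔭` is
`V_ℤ ⊗ 𝒪_𝔭`; `k_𝔭 ≃ ℤ/p`. The `p`-general twin of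
`natCard_point_reductionAt_baseChange_eq_reductionPointCount` (`p = 3`).
[cite: SilvermanAEC2009, Prop. VII.1.3(b) and §VII.2] -/
theorem natCard_point_reductionAt_baseChange_eq_reductionPointCount_prime
    (𝔭 : HeightOneSpectrum (𝓞 K)) (hmem : ((p : ℕ) : 𝓞 K) ∈ 𝔭.asIdeal)
    (hN : Ideal.absNorm 𝔭.asIdeal = p) (hΔ : ¬ (p : ℤ) ∣ minimalDiscriminantInt V) :
    Nat.card ((V.baseChange K).reductionAt 𝔭).toAffine.Point = reductionPointCount V p := by
  set R := 𝔭.adicCompletionIntegers K with hR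
  set X : WeierstrassCurve (𝔭.adicCompletion K) := (V.baseChange K).baseChange (𝔭.adicCompletion K)
    with hX
  haveI hmin : X.IsMinimal R :=
    (isMinimalAt_and_hasGoodReductionAt_baseChange_of_mem V (p := p) hΔ 𝔭 hmem).1
  have hΔX : X.Δ ≠ 0 := by
    rw [hX, baseChange, map_Δ, baseChange, map_Δ]
    refine (map_ne_zero _).mpr ((map_ne_zero _).mpr V.isUnit_Δ.ne_zero)
  -- Mathlib's chosen minimal model vs the given minimal equation
  have h1 : Nat.card ((V.baseChange K).reductionAt 𝔭).toAffine.Point =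
      Nat.card (X.reduction R).toAffine.Point := by
    rw [← natCard_point_reduction_minimal X hΔX]
    rfl
  -- the integral model of `X` is `V_ℤ ⊗ 𝒪_𝔭`
  have h2 : X.integralModel R = (integralModelInt V).map (Int.castRingHom R) := by
    refine integralModel_eq_of_baseChange_eq _ _ ?_
    rw [hX]
    conv_rhs => rw [← map_integralModelInt V]
    rw [baseChange, baseChange, baseChange, map_map, map_map, map_map]
    exact congrArg (integralModelInt V).map (RingHom.ext_int _ _)
  -- the residue field has `p` elements
  have hk : Nat.card (ResidueField R) = p :=
    natCard_residueField_adicCompletionIntegers_eq_of_absNorm 𝔭 hN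
  haveI : Finite (ResidueField R) := Nat.finite_of_card_ne_zero (by rw [hk]; exact hp.out.ne_zero)
  letI : Fintype (ResidueField R) := Fintype.ofFinite _
  have hcard : Fintype.card (ResidueField R) = p := by rw [Fintype.card_eq_nat_card, hk]
  let e : ZMod p ≃+* ResidueField R := ZMod.ringEquivOfPrime (ResidueField R) hp.out hcard
  have h3' : X.reduction R =
      ((integralModelInt V).map (Int.castRingHom (ZMod p))).map (e : ZMod p →+* ResidueField R) := by
    rw [reduction, h2, map_map, map_map]
    exact congrArg (integralModelInt V).map (RingHom.ext_int _ _)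
  rw [h1, h3', natCard_point_map_ringEquiv, reductionPointCount]

/-- **`a_𝔭(V_K) = a_p(V)`** at the prime `𝔭 ∣ p` of norm `p` (`V/ℚ` globally minimal, `p ∤ Δ_min(V)`):
the place-indexed trace of Frobenius of `V_K` (tree `frobeniusTraceAt`: `#k_𝔭 + 1 − #Ẽ_𝔭(k_𝔭)`)
equals the prime-indexed `V.frobeniusTrace p = p + 1 − #V(𝔽_p)`.
[cite: SilvermanAEC2009, C.§16 with Prop. VII.1.3(b)] -/
theorem frobeniusTraceAt_baseChange_eq_frobeniusTrace_prime (𝔭 : HeightOneSpectrum (𝓞 K))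
    (hmem : ((p : ℕ) : 𝓞 K) ∈ 𝔭.asIdeal) (hN : Ideal.absNorm 𝔭.asIdeal = p)
    (hΔ : ¬ (p : ℤ) ∣ minimalDiscriminantInt V) :
    (V.baseChange K).frobeniusTraceAt 𝔭 = V.frobeniusTrace p := by
  rw [frobeniusTraceAt_def, natCard_residueField_adicCompletionIntegers_eq_of_absNorm 𝔭 hN,
    natCard_point_reductionAt_baseChange_eq_reductionPointCount_prime V p 𝔭 hmem hN hΔ, frobeniusTrace]

/-- **`#Ẽ_𝔭(k_𝔭)[p^∞] = #V(𝔽_p)[p^∞]`**: the `p`-primary parts of the two (equinumerous) finite groups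
of points have the same order (`= p^{v_p(#·)}`, tree `natCard_primaryComponent_eq_pow_padicValNat`).
[folklore] -/
theorem natCard_primaryComponent_point_reductionAt_eq_prime (𝔭 : HeightOneSpectrum (𝓞 K))
    (hmem : ((p : ℕ) : 𝓞 K) ∈ 𝔭.asIdeal) (hN : Ideal.absNorm 𝔭.asIdeal = p)
    (hΔ : ¬ (p : ℤ) ∣ minimalDiscriminantInt V) :
    Nat.card (AddCommGroup.primaryComponent ((V.baseChange K).reductionAt 𝔭).toAffine.Point p) =
      Nat.card (AddCommGroup.primaryComponent
        ((integralModelInt V).map (Int.castRingHom (ZMod p))).toAffine.Point p) := by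
  have hc := natCard_point_reductionAt_baseChange_eq_reductionPointCount_prime V p 𝔭 hmem hN hΔ
  haveI : Finite ((V.baseChange K).reductionAt 𝔭).toAffine.Point := by
    refine Nat.finite_of_card_ne_zero ?_
    rw [hc, reductionPointCount]
    exact Nat.card_pos.ne'
  rw [natCard_primaryComponent_eq_pow_padicValNat, natCard_primaryComponent_eq_pow_padicValNat, hc,
    reductionPointCount]

/-- **Packaged `K`-side datum for `K = ℚ(ζ_p)`** (`V/ℚ` globally minimal with good reduction at `p`):
there is a finite place `𝔭` of `K` which is the ONLY place above `p`, at which `V ⊗ K` is a minimal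
model with good reduction, with `N(𝔭) = p`, `a_𝔭(V_K) = a_p(V)` and
`#Ẽ_𝔭(k_𝔭)[p^∞] = #V(𝔽_p)[p^∞]` — everything the projection
`Greenberg1999.thm41_charValue_rankZero_numberField.of_unique_prime` consumes.
[cite: SilvermanAEC2009, Prop. VII.1.3(b), VII.5.1(a)] -/
theorem exists_unique_prime_reduction_data [IsCyclotomicExtension {p} ℚ K]
    (hgood : V.HasGoodReductionAtPrime p) :
    ∃ 𝔭 : HeightOneSpectrum (𝓞 K), ((p : ℕ) : 𝓞 K) ∈ 𝔭.asIdeal ∧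
      {v : HeightOneSpectrum (𝓞 K) | ((p : ℕ) : 𝓞 K) ∈ v.asIdeal} = {𝔭} ∧
      Ideal.absNorm 𝔭.asIdeal = p ∧
      (V.baseChange K).IsMinimalAt 𝔭 ∧ (V.baseChange K).HasGoodReductionAt 𝔭 ∧
      (V.baseChange K).frobeniusTraceAt 𝔭 = V.frobeniusTrace p ∧
      Nat.card (AddCommGroup.primaryComponent ((V.baseChange K).reductionAt 𝔭).toAffine.Point p) =
        Nat.card (AddCommGroup.primaryComponent
          ((integralModelInt V).map (Int.castRingHom (ZMod p))).toAffine.Point p) := by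
  have hΔ : ¬ (p : ℤ) ∣ minimalDiscriminantInt V :=
    fun hdvd ↦ V.not_hasGoodReductionAtPrime_of_dvd_minimalDiscriminantInt p hdvd hgood
  obtain ⟨𝔭, hmem, huniq, hN⟩ := exists_prime_over_prime p K
  obtain ⟨hmin, hgd⟩ := isMinimalAt_and_hasGoodReductionAt_baseChange_of_mem V (K := K) hΔ 𝔭 hmem
  exact ⟨𝔭, hmem, huniq, hN, hmin, hgd,
    frobeniusTraceAt_baseChange_eq_frobeniusTrace_prime V p 𝔭 hmem hN hΔ,
    natCard_primaryComponent_point_reductionAt_eq_prime V p 𝔭 hmem hN hΔ⟩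

end Reduction

end Summit.BirchSwinnertonDyer.Rank1Residual.Additive

end
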